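import Literature.AlgebraicGeometry.Deligne1982.WeilTypeCMMumfordTateGroupOnH1
import HarnessLib

/-!
# Scalars in `U(φ)`, `SU(φ)`, `S(A)`; for the general CM-Weil abelian variety `MT(A)(ℂ)|_{H¹} ∩ U(φ)(ℂ) = MT(A)(ℂ)|_{H¹} ∩ S(A)(ℂ) = SU(φ)(ℂ) = Hg(A)(ℂ)|_{H¹}`

Milne [Milne1999LefschetzClasses, §4 p. 659]: the weight `w : 𝔾_m → L(A)` and the multiplier `l(A) : L(A) → 𝔾_m`
satisfy «`l ∘ w = -2`» and «the kernel of `l(A)` … equals `S(A)`» — so a scalar lies in `S(A)` iff its square is `1`;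
p. 660 and Prop. 4.8: `L(A) ⊃ Hg(A)`, `Hg′(A)` versus `S(A)`. Milne [Milne2025AbelianMotivesCharP, §1.5 Example 1.17]:
the rows `SU(φ) ↪ MT(A)` and `GU(φ) ↪ L(A)` for the general Weil-type `A`. Deligne [Deligne1982HodgeCycles, I Prop. 3.4,
§4 and Milne's endnote 16]: `MT = 𝔾_m · Hg`, `Hg = SU(φ)` for the general member.

On the tree's carriers (`(A, η, h)`, `IsWeilTypeCM A η R e₀ k`, `h` a polarization class with the Rosati condition; all
`theorem`s, no definition, no named fact):
* **scalars**: `c · 1 ∈ U(φ)(ℂ)` iff `c² = 1` (the form `Q_h` is non-degenerate), `c · 1 ∈ S(A)(ℂ)` iff `c² = 1`,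
  `c · 1 ∈ SU(φ)(ℂ)` iff `c² = 1` (determinant `c^{2k} = (c²)ᵏ` on each `2k`-dimensional eigenspace); in particular
  `-1 ∈ SU(φ)(ℂ)`;
* **`MT(A)(ℂ)|_{H¹} ∩ U(φ)(ℂ) ⊆ SU(φ)(ℂ)` for EVERY CM-Weil abelian variety** (`MT|_{H¹} ⊆ ℂˣ · SU(φ)(ℂ)` and the
  scalar is forced to be `±1 ∈ SU(φ)(ℂ)`), hence `MT(A)(ℂ)|_{H¹} ∩ S(A)(ℂ) ⊆ SU(φ)(ℂ)`;
* **for the GENERAL member** (`Hg(A) = SU(φ)`): `MT(A)(ℂ)|_{H¹} ⊓ U(φ)(ℂ) = SU(φ)(ℂ) = Hg(A)(ℂ)|_{H¹}`, and for `k ≥ 2`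
  (where `S(A)(ℂ) = U(φ)(ℂ)`) **`MT(A)(ℂ)|_{H¹} ⊓ S(A)(ℂ) = Hg(A)(ℂ)|_{H¹}`** — the pull-back square of Milne's two rows:
  `Hg′ = MT ∩ ker l` on `H¹`.

## References

* [Milne1999LefschetzClasses] J. S. Milne, *Lefschetz classes on abelian varieties*, Duke Math. J. 96 (1999), §1 p. 644,
  §4 p. 659 (`w`, `l`, `l ∘ w = -2`, `ker l = S(A)`), p. 660, Prop. 4.8.
* [Milne2025AbelianMotivesCharP] J. S. Milne, *Abelian motives in characteristic p*, arXiv:2508.09972, §1.5 Ex. 1.17.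
* [Deligne1982HodgeCycles] P. Deligne (notes by J. S. Milne), LNM 900 (1982), I Prop. 3.4, §4; Milne 2003 endnote 16.
* [vanGeemen1994HodgeAV] B. van Geemen, LNM 1594 (1994), 6.9, Lemma 6.10, Thm. 6.11.
-/

noncomputable section

open CategoryTheory Polynomial
open Literature.AlgebraicTopology.SingularHomology
open Literature.AlgebraicGeometry.Motives
open Literature.AlgebraicGeometry.HodgeTheory
open Literature.AlgebraicGeometry.VanGeemen1994
open Literature.AlgebraicGeometry.Milne1999

namespace Literature.AlgebraicGeometry.Deligne1982

variable {A : AbelianVariety ℂ} {η : A ⟶ A} {R : Polynomial ℤ} {e₀ k : ℕ} {h : complexBetti A.X 2}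

/-- The scalar automorphism `c · 1`, evaluated. [folklore] -/
private theorem smulOfUnit_apply₀ (c : ℂˣ) (x : complexBetti A.X 1) :
    LinearEquiv.smulOfUnit c x = (c : ℂ) • x := by
  simp [LinearEquiv.smulOfUnit, Units.smul_def]

/-! ### §1 Scalars in `U(φ)(ℂ)`, `S(A)(ℂ)`, `SU(φ)(ℂ)` -/

/-- **`c · 1 ∈ U(φ)(ℂ)` iff `c² = 1`** for a polarization class `h` on an abelian variety of positive dimension
(`Q_h(cx, cy) = c² Q_h(x, y)` and `Q_h` is non-degenerate: hard Lefschetz in degree one and Poincaré duality, the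
tree's `Milne1999.eq_zero_of_forall_polarizationPairingOne_eq_zero_of_hasHardLefschetzProperty`).
[cite: Milne1999LefschetzClasses, §4 p. 659 (l ∘ w = -2)] [cite: Deligne1982HodgeCycles, Milne 2003 re-edition endnote 16] -/
theorem smulOfUnit_mem_weilUnitaryGroupCM_iff (hpol : IsPolarizationClass A.dim A.X h) (hA : 1 ≤ A.dim) (η : A ⟶ A)
    {c : ℂˣ} : LinearEquiv.smulOfUnit c ∈ weilUnitaryGroupCM A η h ↔ (c : ℂ) ^ 2 = 1 := by
  classical
  constructor
  · rintro ⟨-, hQ⟩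
    by_contra hc
    have hzero : ∀ x y, polarizationPairingOne A.X h (A.dim - 1) x y = 0 := by
      intro x y
      have e := hQ x y
      rw [smulOfUnit_apply₀, smulOfUnit_apply₀, map_smul, map_smul, LinearMap.smul_apply, smul_smul, ← sq] at e
      have e3 : ((c : ℂ) ^ 2 - 1) • polarizationPairingOne A.X h (A.dim - 1) x y = 0 := by
        rw [sub_smul, one_smul, e, sub_self]
      exact (smul_eq_zero.1 e3).resolve_left (sub_ne_zero.2 hc)
    haveI := finite_complexBetti_abelianVariety A 1
    have hV : Module.finrank ℂ (complexBetti A.X 1) = 2 * A.dim := AbelianVariety.finrank_complexBetti_one A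
    obtain ⟨x, hx⟩ : ∃ x : complexBetti A.X 1, x ≠ 0 := by
      by_contra hall
      haveI : Subsingleton (complexBetti A.X 1) :=
        subsingleton_of_forall_eq 0 fun x ↦ not_not.1 (not_exists.1 hall x)
      have h0 : Module.finrank ℂ (complexBetti A.X 1) = 0 := Module.finrank_zero_of_subsingleton
      omega
    exact hx (eq_zero_of_forall_polarizationPairingOne_eq_zero_of_hasHardLefschetzProperty hA hpol.hasHardLefschetz
      fun y ↦ hzero x y)
  · intro hc
    refine ⟨fun x ↦ by rw [smulOfUnit_apply₀, smulOfUnit_apply₀, map_smul], fun x y ↦ ?_⟩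
    rw [smulOfUnit_apply₀, smulOfUnit_apply₀, map_smul, map_smul, LinearMap.smul_apply, smul_smul, ← sq, hc, one_smul]

/-- **`c · 1 ∈ S(A)(ℂ)` iff `c² = 1`** (`S(A) = ker l`, `l ∘ w = -2`) for a polarization class `h`, `dim A ≥ 1`.
[cite: Milne1999LefschetzClasses, §4 p. 659 (l ∘ w = -2, ker l = S(A))] -/
theorem smulOfUnit_mem_unitaryCentralizerGroup_iff (hpol : IsPolarizationClass A.dim A.X h) (hA : 1 ≤ A.dim)
    {c : ℂˣ} : LinearEquiv.smulOfUnit c ∈ unitaryCentralizerGroup A h ↔ (c : ℂ) ^ 2 = 1 := by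
  constructor
  · exact fun hu ↦ (smulOfUnit_mem_weilUnitaryGroupCM_iff hpol hA (𝟙 A)).1
      (unitaryCentralizerGroup_le_weilUnitaryGroupCM (𝟙 A) h hu)
  · intro hc
    exact ⟨(smulOfUnit_mem_similitudeCentralizerGroup A h c).1,
      ((smulOfUnit_mem_weilUnitaryGroupCM_iff hpol hA (𝟙 A)).2 hc).2⟩

section CM

variable (hW : IsWeilTypeCM A η R e₀ k) (hpol : IsPolarizationClass A.dim A.X h) (hRos : IsRosatiCM A η h)

omit hRos in
include hW hpol in
/-- **`c · 1 ∈ SU(φ)(ℂ)` iff `c² = 1`**: the scalar `c` has determinant `c^{2k} = (c²)ᵏ` on each `2k`-dimensional eigenspace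
`H¹_σ = ker(η^* - σ(η))`. [cite: Deligne1982HodgeCycles, §4 p. 32 and Milne 2003 re-edition endnote 16]
[cite: vanGeemen1994HodgeAV, 6.9 and Lemma 6.10] -/
theorem IsWeilTypeCM.smulOfUnit_mem_weilSpecialUnitaryGroupCM_iff {c : ℂˣ} :
    LinearEquiv.smulOfUnit c ∈ weilSpecialUnitaryGroupCM A η (R.comp (X ^ 2)) h ↔ (c : ℂ) ^ 2 = 1 := by
  have hA : 1 ≤ A.dim := by have := hW.two_le_dim; omega
  constructor
  · exact fun hu ↦ (smulOfUnit_mem_weilUnitaryGroupCM_iff hpol hA η).1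
      (weilSpecialUnitaryGroupCM_le_weilUnitaryGroupCM A η _ h hu)
  · intro hc
    obtain ⟨hcomm, hQ⟩ := (smulOfUnit_mem_weilUnitaryGroupCM_iff hpol hA η).2 hc
    refine ⟨hcomm, hQ, fun ρ hρ ↦ ?_⟩
    -- `det(c · 1 | H¹_ρ) = c^{dim H¹_ρ} = c^{2k} = (c²)ᵏ = 1`
    unfold detOnEigenspace
    have e : ((LinearEquiv.smulOfUnit c : complexBetti A.X 1 ≃ₗ[ℂ] complexBetti A.X 1) :
          complexBetti A.X 1 →ₗ[ℂ] complexBetti A.X 1).restrict (mapsTo_eigenspace_of_comm hcomm ρ) =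
        (c : ℂ) • LinearMap.id := by
      ext x
      rw [LinearMap.coe_restrict_apply, LinearMap.smul_apply, LinearMap.id_apply, Submodule.coe_smul,
        LinearEquiv.coe_coe, smulOfUnit_apply₀]
    rw [e, LinearMap.det_smul, LinearMap.det_id, mul_one]
    change (c : ℂ) ^ Module.finrank ℂ (eig A η ρ) = 1
    rw [hW.finrank_eig hρ, pow_mul, hc, one_pow]

omit hRos in
include hW hpol in
/-- `-1 ∈ SU(φ)(ℂ)`. [cite: vanGeemen1994HodgeAV, 6.9 and Lemma 6.10] -/
theorem IsWeilTypeCM.smulOfUnit_neg_one_mem_weilSpecialUnitaryGroupCM :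
    LinearEquiv.smulOfUnit (-1 : ℂˣ) ∈ weilSpecialUnitaryGroupCM A η (R.comp (X ^ 2)) h :=
  (hW.smulOfUnit_mem_weilSpecialUnitaryGroupCM_iff hpol).2 (by simp)

/-! ### §2 `MT(A)(ℂ)|_{H¹} ∩ U(φ)(ℂ) ⊆ SU(φ)(ℂ)` for every CM-Weil abelian variety -/

omit hRos in
include hW hpol in
/-- **`MT(A)(ℂ)|_{H¹} ∩ U(φ)(ℂ) ⊆ SU(φ)(ℂ)` for EVERY CM-Weil abelian variety**: `u = c · u'` with `u' ∈ SU(φ)(ℂ)`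
(`MT|_{H¹} ⊆ ℂˣ · SU(φ)`); if also `u ∈ U(φ)(ℂ)` then `c · 1 = u u'⁻¹ ∈ U(φ)(ℂ)`, so `c² = 1` and `c · 1 ∈ SU(φ)(ℂ)`.
[cite: Deligne1982HodgeCycles, I Prop. 3.4 and §4 (4.4)] [cite: Milne1999LefschetzClasses, §4 p. 659 (l ∘ w = -2)] -/
theorem IsWeilTypeCM.mem_weilSpecialUnitaryGroupCM_of_mem_map_mumfordTateGroup_of_mem
    {u : complexBetti A.X 1 ≃ₗ[ℂ] complexBetti A.X 1}
    (hm : u ∈ (mumfordTateGroup A.dim A.X).map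
      (Pi.evalMonoidHom (fun k : ℕ ↦ complexBetti A.X k ≃ₗ[ℂ] complexBetti A.X k) 1))
    (hu : u ∈ weilUnitaryGroupCM A η h) : u ∈ weilSpecialUnitaryGroupCM A η (R.comp (X ^ 2)) h := by
  have hA : 1 ≤ A.dim := by have := hW.two_le_dim; omega
  obtain ⟨c, u', hu', rfl⟩ := mem_map_mumfordTateGroup_one_iff.1 hm
  have hu'S := hW.hodgeGroupOne_le_weilSpecialUnitaryGroupCM (mem_hodgeClassSpan_one_of_isPolarizationClass hW hpol) hu'
  have hcU : LinearEquiv.smulOfUnit c ∈ weilUnitaryGroupCM A η h := by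
    have e : LinearEquiv.smulOfUnit c = (LinearEquiv.smulOfUnit c * u') * u'⁻¹ := by rw [mul_inv_cancel_right]
    rw [e]
    exact (weilUnitaryGroupCM A η h).mul_mem hu
      ((weilUnitaryGroupCM A η h).inv_mem (weilSpecialUnitaryGroupCM_le_weilUnitaryGroupCM A η _ h hu'S))
  have hc : (c : ℂ) ^ 2 = 1 := (smulOfUnit_mem_weilUnitaryGroupCM_iff hpol hA η).1 hcU
  exact (weilSpecialUnitaryGroupCM A η _ h).mul_mem ((hW.smulOfUnit_mem_weilSpecialUnitaryGroupCM_iff hpol).2 hc) hu'S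

omit hRos in
include hW hpol in
/-- **`MT(A)(ℂ)|_{H¹} ⊓ U(φ)(ℂ) ≤ SU(φ)(ℂ)`** for every CM-Weil abelian variety. [cite: Deligne1982HodgeCycles, I Prop. 3.4 and §4 (4.4)]
[cite: Milne1999LefschetzClasses, §4 p. 659] -/
theorem IsWeilTypeCM.map_mumfordTateGroup_inf_weilUnitaryGroupCM_le :
    (mumfordTateGroup A.dim A.X).map
        (Pi.evalMonoidHom (fun k : ℕ ↦ complexBetti A.X k ≃ₗ[ℂ] complexBetti A.X k) 1) ⊓ weilUnitaryGroupCM A η h ≤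
      weilSpecialUnitaryGroupCM A η (R.comp (X ^ 2)) h :=
  fun _ hu ↦ hW.mem_weilSpecialUnitaryGroupCM_of_mem_map_mumfordTateGroup_of_mem hpol hu.1 hu.2

omit hRos in
include hW hpol in
/-- **`MT(A)(ℂ)|_{H¹} ⊓ S(A)(ℂ) ≤ SU(φ)(ℂ)`** for every CM-Weil abelian variety (`S(A)(ℂ) ≤ U(φ)(ℂ)`).
[cite: Milne1999LefschetzClasses, §1 p. 644 and §4 pp. 659–660] [cite: Deligne1982HodgeCycles, §4 (4.4)] -/
theorem IsWeilTypeCM.map_mumfordTateGroup_inf_unitaryCentralizerGroup_le :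
    (mumfordTateGroup A.dim A.X).map
        (Pi.evalMonoidHom (fun k : ℕ ↦ complexBetti A.X k ≃ₗ[ℂ] complexBetti A.X k) 1) ⊓ unitaryCentralizerGroup A h ≤
      weilSpecialUnitaryGroupCM A η (R.comp (X ^ 2)) h :=
  fun _ hu ↦ hW.mem_weilSpecialUnitaryGroupCM_of_mem_map_mumfordTateGroup_of_mem hpol hu.1
    (unitaryCentralizerGroup_le_weilUnitaryGroupCM η h hu.2)

/-! ### §3 The general member: `MT(A)(ℂ)|_{H¹} ⊓ U(φ)(ℂ) = MT(A)(ℂ)|_{H¹} ⊓ S(A)(ℂ) = Hg(A)(ℂ)|_{H¹}` -/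

omit hRos in
include hW hpol in
/-- **`MT(A)(ℂ)|_{H¹} ⊓ U(φ)(ℂ) = SU(φ)(ℂ)` FOR THE GENERAL CM-WEIL ABELIAN VARIETY** (`Hg(A) = SU(φ)`): the top row of
Milne's diagram is the pull-back of the bottom row along `MT(A) ↪ L(A)` on `H¹`.
[cite: Milne2025AbelianMotivesCharP, §1.5 Example 1.17] [cite: Deligne1982HodgeCycles, Milne 2003 re-edition endnote 16] -/
theorem IsWeilTypeCM.map_mumfordTateGroup_inf_weilUnitaryGroupCM_eq_of_hodgeGroupSU
    (hSU : HasHodgeGroupSUCM A η (R.comp (X ^ 2)) h) :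
    (mumfordTateGroup A.dim A.X).map
        (Pi.evalMonoidHom (fun k : ℕ ↦ complexBetti A.X k ≃ₗ[ℂ] complexBetti A.X k) 1) ⊓ weilUnitaryGroupCM A η h =
      weilSpecialUnitaryGroupCM A η (R.comp (X ^ 2)) h :=
  le_antisymm (hW.map_mumfordTateGroup_inf_weilUnitaryGroupCM_le hpol)
    (le_inf (weilSpecialUnitaryGroupCM_le_map_mumfordTateGroup_of_hasHodgeGroupSUCM hSU)
      (weilSpecialUnitaryGroupCM_le_weilUnitaryGroupCM A η _ h))

omit hRos in
include hW hpol in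
/-- **`MT(A)(ℂ)|_{H¹} ⊓ U(φ)(ℂ) = Hg(A)(ℂ)|_{H¹}`** for the general CM-Weil abelian variety.
[cite: Milne2025AbelianMotivesCharP, §1.5 Example 1.17] [cite: Deligne1982HodgeCycles, I Prop. 3.4 and Milne 2003 re-edition endnote 16] -/
theorem IsWeilTypeCM.map_mumfordTateGroup_inf_weilUnitaryGroupCM_eq_hodgeGroupOne_of_hodgeGroupSU
    (hSU : HasHodgeGroupSUCM A η (R.comp (X ^ 2)) h) :
    (mumfordTateGroup A.dim A.X).map
        (Pi.evalMonoidHom (fun k : ℕ ↦ complexBetti A.X k ≃ₗ[ℂ] complexBetti A.X k) 1) ⊓ weilUnitaryGroupCM A η h =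
      hodgeGroupOne A.dim A.X := by
  rw [hW.map_mumfordTateGroup_inf_weilUnitaryGroupCM_eq_of_hodgeGroupSU hpol hSU, hasHodgeGroupSUCM_iff.1 hSU]

include hW hpol hRos in
/-- **`MT(A)(ℂ)|_{H¹} ⊓ S(A)(ℂ) = Hg(A)(ℂ)|_{H¹}` FOR THE GENERAL CM-WEIL ABELIAN VARIETY** (`Hg(A) = SU(φ)`, `k ≥ 2`, where
`S(A)(ℂ) = U(φ)(ℂ)`): on `H¹`, `Hg′(A) = MT(A) ∩ ker l(A)` — Milne's `Hg′` versus `S` (Prop. 4.8) for the Weil family.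
[cite: Milne2025AbelianMotivesCharP, §1.5 Example 1.17] [cite: Milne1999LefschetzClasses, §4 pp. 659–660 and Prop. 4.8] -/
theorem IsWeilTypeCM.map_mumfordTateGroup_inf_unitaryCentralizerGroup_eq_hodgeGroupOne_of_hodgeGroupSU (hk : 2 ≤ k)
    (hSU : HasHodgeGroupSUCM A η (R.comp (X ^ 2)) h) :
    (mumfordTateGroup A.dim A.X).map
        (Pi.evalMonoidHom (fun k : ℕ ↦ complexBetti A.X k ≃ₗ[ℂ] complexBetti A.X k) 1) ⊓ unitaryCentralizerGroup A h =
      hodgeGroupOne A.dim A.X := by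
  rw [hW.unitaryCentralizerGroup_eq_weilUnitaryGroupCM_of_hodgeGroupSU hpol hRos hk hSU]
  exact hW.map_mumfordTateGroup_inf_weilUnitaryGroupCM_eq_hodgeGroupOne_of_hodgeGroupSU hpol hSU

/-- `Hg(A)(ℂ)|_{H¹} ≤ MT(A)(ℂ)|_{H¹} ⊓ S(A)(ℂ)` for every abelian variety and every `h ∈ B¹(A) ⊗ ℂ` («`L(A) ⊃ Hg(A)`»).
[cite: Milne1999LefschetzClasses, §4 p. 660] -/
theorem hodgeGroupOne_le_map_mumfordTateGroup_inf_unitaryCentralizerGroup (hh : h ∈ hodgeClassSpan A.dim A.X 1) :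
    hodgeGroupOne A.dim A.X ≤ (mumfordTateGroup A.dim A.X).map
        (Pi.evalMonoidHom (fun k : ℕ ↦ complexBetti A.X k ≃ₗ[ℂ] complexBetti A.X k) 1) ⊓ unitaryCentralizerGroup A h :=
  le_inf hodgeGroupOne_le_map_mumfordTateGroup (hodgeGroupOne_le_unitaryCentralizerGroup hh)

end CM

end Literature.AlgebraicGeometry.Deligne1982

end
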